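import Summits.QuantumFields.BalabanUV.Beta.AxialDressingRootedBmKernel

/-!
# The `mm`-read of a Π_bm-co-dressed kernel is the `mm`-read of the kernel

`coDressKBmAt ρ N K = Πᵀ ∘ K ∘ Π` with `Π = piKBm ρ N = Π_bm ⊕ 1` (identity on the multiplier legs, zero on the mixed blocks:
`piKBm_inr_inr`, `piKBm_inl_inr`, `piKBm_inr_inl`).  Hence the multiplier–multiplier block of the co-dressed kernel is that of `K`
(`coDressKBmAt_inr_inr`), and so is its `mm`-read (`mmRead_coDressKBmAt`).  Used by the re-typed hR leaf (L3) (decision (L3-D), GAP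
C-an2-75): the value-function jet `e3OfK N Ĝ S` over the co-dressed resolvent reads the SAME multiplier response `mmRead N KInv` as
the straight one; only the vertex weights and the sandwich's field legs are dressed.  [folklore]; axioms standard; no file touched.
-/

open Finset
open scoped BigOperators
open Literature.MathematicalPhysics.QuantumFieldTheory
open Literature.MathematicalPhysics.QuantumFieldTheory.Balaban1983to89
open Literature.MathematicalPhysics.QuantumFieldTheory.Balaban1983to89.Beta
open ExpKernelCalculus (MKer comp)
open OneStepResolventKernel (Fib)
open BalabanStepJetsSucc (mmRead mmRead_inl_inl)
open Summit.QuantumFields.BalabanUV.Beta.TameKernelCalculus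

namespace Summit.QuantumFields.BalabanUV.Beta.AxialDressingRooted

noncomputable section

variable {d : ℕ} (ρ : Fin (d + 1) → ℤ) (N : ℕ)

/-- [folklore] Left composition with `trK (piKBm ρ N)` does not touch a multiplier row. -/
theorem comp_trK_piKBm_inr (A : MKer (d + 1) (Fib d)) (x y : Fin (d + 1) → ℤ) (μ : Fin (d + 1)) (b : Fib d) :
    comp (trK (piKBm ρ N)) A x y (Sum.inr μ) b = A x y (Sum.inr μ) b := by
  unfold ExpKernelCalculus.comp
  have h : ∀ u, ∑ f : Fib d, trK (piKBm ρ N) x u (Sum.inr μ) f * A u y f b = if u = x then A u y (Sum.inr μ) b else 0 := by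
    intro u
    rw [Fintype.sum_sum_type]
    simp only [trK, piKBm_inl_inr, zero_mul, Finset.sum_const_zero, zero_add, piKBm_inr_inr]
    by_cases hu : u = x
    · simp only [hu, true_and, ite_mul, one_mul, zero_mul, Finset.sum_ite_eq', Finset.mem_univ, if_true]
    · simp [hu]
  simp_rw [h]
  rw [tsum_point' x]

/-- [folklore] **THE MULTIPLIER–MULTIPLIER BLOCK OF THE CO-DRESSED KERNEL IS THAT OF `K`.** -/
theorem coDressKBmAt_inr_inr (K : MKer (d + 1) (Fib d)) (x y : Fin (d + 1) → ℤ) (μ μ' : Fin (d + 1)) :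
    coDressKBmAt ρ N K x y (Sum.inr μ) (Sum.inr μ') = K x y (Sum.inr μ) (Sum.inr μ') := by
  rw [coDressKBmAt_eq, comp_piKBm_inr, comp_trK_piKBm_inr]

/-- [folklore] **THE `mm`-READ OF THE CO-DRESSED KERNEL IS THE `mm`-READ OF `K`** (any reading scale `M`). -/
theorem mmRead_coDressKBmAt (M : ℕ) (K : MKer (d + 1) (Fib d)) : mmRead M (coDressKBmAt ρ N K) = mmRead M K := by
  funext x' z' a b
  rcases a with α | m <;> rcases b with β | m'
  · rw [mmRead_inl_inl, mmRead_inl_inl, coDressKBmAt_inr_inr]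
  · rfl
  · rfl
  · rfl

end

end Summit.QuantumFields.BalabanUV.Beta.AxialDressingRooted
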